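import Mathlib.FieldTheory.Finiteness
import Mathlib.Algebra.Field.IsField
import Mathlib.LinearAlgebra.Dimension.Free
import Summits.BirchSwinnertonDyer.Rank1Residual.F1Sign2.CopyAlignmentAtTwo
import Literature.NumberTheory.EllipticCurves.NewformsHeckeProofs
import Literature.NumberTheory.EllipticCurves.ModularSymbolsLattice
import HarnessLib

/-!
# Crux C1 `MainConjectureTransportAlignedAtTwo` (stmt-BirchSwinnertonDyer-22296), line `birth`, residual (R2) `stub_lamLawKilford` (Kilford stratum):
# READING `F1Sign2.MultiplicityTwoOnStratumAtTwo` AS A CARDINALITY — `finrank_{𝕋/𝔪_f} J₀(N)[𝔪_f] = 4` and `#(𝕋/𝔪_f) = 2` give `#J₀(N)[𝔪_f] = 16`,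
# the form in which `…KilfordCopySameCopy.range_eq_range_of_eq_of_mem` consumes multiplicity two (width seat att-p3 g17; `--supports 22296`; part 4)

THEOREMS ONLY (no `def`, no `sorry`, no named fact); elementary. BSD is not proved by this; C1 is not closed by this.

* `isField_of_natCard_eq_two` — a commutative ring with exactly two elements is a field.
* `natCard_eq_of_natCard_ring_eq_two` — over such a ring a module of `finrank 4` has `16` elements (`Module.natCard_eq_pow_finrank`).
* `natCard_torsionBySet_modTwoHeckeIdeal_eq` — for `f ∈ S₂(Γ₀(N))` with `#(𝕋 ⧸ 𝔪_f) = 2`, the conclusion of `MultiplicityTwoOnStratumAtTwo` at `f`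
  (`Module.finrank (𝕋 ⧸ 𝔪_f) (J₀(N)[𝔪_f]) = 4`) is `Nat.card (J₀(N)[𝔪_f]) = 16`.
* `exists_int_toEnd_apply_eq_smul` — every `t ∈ 𝕋_ℤ` acts on the newform of an elliptic curve by an INTEGER (`T_p f = a_p(E) f`, the tree
  theorem `IsNewform0.heckeT_eq_coeff_smul`, + `Algebra.adjoin_induction`); **`natCard_quotient_modTwoHeckeIdeal_eq_two`** — hence `#(𝕋 ⧸ 𝔪_f) = 2`
  UNCONDITIONALLY for the newform of an elliptic curve (REF1-AUDIT §34 had this «modulo `IsNewform0.heckeEigenvalue_eq_coeff`»; that fact is a tree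
  theorem); **`natCard_torsionBySet_eq_sixteen_of_isNewformOf`** — MULT2's conclusion at `(N, f)` ⟹ `#J₀(N)[𝔪_f] = 16`, no further input.

References (for the reading): [KilfordWiese2008, Question 1.9]; [Wiese2007Multiplicities, Cor. 4.2].
-/

set_option autoImplicit false

noncomputable section

-- justification: the `Summit.BirchSwinnertonDyer.BirchSwinnertonDyer.…` path repeats a component (route-file convention)
set_option linter.dupNamespace false

namespace Summit.BirchSwinnertonDyer.BirchSwinnertonDyer.Theorems.AlignedTransportAtTwoKilfordCopyMultiplicityCard

/-- A commutative ring with exactly two elements is a field (`{0, 1}`, `1⁻¹ = 1`). [folklore] -/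
theorem isField_of_natCard_eq_two {R : Type*} [CommRing R] (hR : Nat.card R = 2) : IsField R := by
  obtain ⟨x, y, hxy, hxyU⟩ := Nat.card_eq_two_iff.mp hR
  have h01 : (0 : R) ≠ 1 := by
    intro h
    haveI : Subsingleton R := subsingleton_of_zero_eq_one h
    exact hxy (Subsingleton.elim x y)
  refine ⟨⟨0, 1, h01⟩, mul_comm, fun {a} ha => ⟨1, ?_⟩⟩
  -- `a ≠ 0` forces `a = 1`: the two elements are `0` and `1`
  have hmem : ∀ z : R, z = x ∨ z = y := fun z => by
    have hz : z ∈ ({x, y} : Set R) := by rw [hxyU]; exact Set.mem_univ z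
    simpa using hz
  have ha1 : a = 1 := by
    rcases hmem a with rfl | rfl <;> rcases hmem 0 with h0 | h0 <;> rcases hmem 1 with h1 | h1
    all_goals first
      | exact absurd h0.symm ha
      | exact h1.symm
      | exact absurd (h0.trans h1.symm) h01
  rw [ha1, mul_one]

/-- Over a commutative ring with two elements a module of `finrank 4` has exactly `16` elements. [folklore] -/
theorem natCard_eq_of_natCard_ring_eq_two {R M : Type*} [CommRing R] [AddCommGroup M] [Module R M]
    (hR : Nat.card R = 2) (h4 : Module.finrank R M = 4) : Nat.card M = 16 := by
  letI : Field R := (isField_of_natCard_eq_two hR).toField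
  haveI : Module.Finite R M := Module.finite_of_finrank_pos (by rw [h4]; norm_num)
  rw [Module.natCard_eq_pow_finrank (K := R) (V := M), hR, h4]
  norm_num

open CongruenceSubgroup Literature.NumberTheory.EllipticCurves.ModularForms Summit.BirchSwinnertonDyer.Rank1Residual.F1Sign2 in
/-- **MULT2 as a cardinality.** For `f ∈ S₂(Γ₀(N))` with `#(𝕋 ⧸ 𝔪_f) = 2`: `finrank_{𝕋/𝔪_f} J₀(N)[𝔪_f] = 4` (the conclusion of
`F1Sign2.MultiplicityTwoOnStratumAtTwo` at `f`) gives `#J₀(N)[𝔪_f] = 16` — the hypothesis `Nat.card U = 16` of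
`…KilfordCopySameCopy.range_eq_range_of_eq_of_mem`. [cite: KilfordWiese2008, Question 1.9] -/
theorem natCard_torsionBySet_modTwoHeckeIdeal_eq {N : ℕ} [NeZero N] (f : CuspForm (Gamma0 N) 2)
    (h2 : Nat.card (HeckeRing0 N 2 ⧸ modTwoHeckeIdeal f) = 2)
    (h4 : Module.finrank (HeckeRing0 N 2 ⧸ modTwoHeckeIdeal f)
      (Submodule.torsionBySet (HeckeRing0 N 2) (J0 N) (modTwoHeckeIdeal f)) = 4) :
    Nat.card (Submodule.torsionBySet (HeckeRing0 N 2) (J0 N) (modTwoHeckeIdeal f)) = 16 :=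
  natCard_eq_of_natCard_ring_eq_two h2 h4

/-! ## `𝕋 ⧸ 𝔪_f ≅ 𝔽₂` for the newform of an elliptic curve -/

section Newform

open CongruenceSubgroup Literature.NumberTheory.EllipticCurves Literature.NumberTheory.EllipticCurves.ModularForms
  Summit.BirchSwinnertonDyer.Rank1Residual.F1Sign2

variable {N : ℕ} [NeZero N] {W : WeierstrassCurve ℚ} {f : CuspForm (Gamma0 N) 2}

/-- Every element of the full Hecke ring `𝕋_ℤ = ℤ[T_p]` acts on the newform `f` of an elliptic curve `W` by an INTEGER:
`t f = m • f` (`T_p f = a_p(W) f` with `a_p(W) ∈ ℤ`, then induction over `Algebra.adjoin`). [folklore] -/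
theorem exists_int_toEnd_apply_eq_smul (hf : IsNewformOf W f) (t : HeckeRing0 N 2) :
    ∃ m : ℤ, HeckeRing0.toEnd N 2 t f = (m : ℂ) • f := by
  rw [HeckeRing0.toEnd_apply]
  suffices h : ∀ s : Module.End ℂ (CuspForm (Gamma0 N) 2), s ∈ heckeRing0 N 2 → ∃ m : ℤ, s f = (m : ℂ) • f from
    h _ (HeckeRing0.toSubalgebra N 2 t).2
  intro s hs
  change s ∈ Algebra.adjoin ℤ (heckeRing0Generators N 2) at hs
  induction hs using Algebra.adjoin_induction with
  | mem x hx =>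
    obtain ⟨p, hp, rfl⟩ := hx
    haveI : NeZero p := ⟨hp.ne_zero⟩
    refine ⟨W.LFunction p, ?_⟩
    rw [IsNewform0.heckeT_eq_coeff_smul hf.1 hp]
    exact congrArg (· • f) (hf.2 p)
  | algebraMap r =>
    refine ⟨r, ?_⟩
    rw [Algebra.algebraMap_eq_smul_one, LinearMap.smul_apply, Module.End.one_apply, Int.cast_smul_eq_zsmul]
  | add x y _ _ hx hy =>
    obtain ⟨m, hm⟩ := hx
    obtain ⟨n, hn⟩ := hy
    exact ⟨m + n, by rw [LinearMap.add_apply, hm, hn, Int.cast_add, add_smul]⟩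
  | mul x y _ _ hx hy =>
    obtain ⟨m, hm⟩ := hx
    obtain ⟨n, hn⟩ := hy
    exact ⟨m * n, by rw [Module.End.mul_apply, hn, map_smul, hm, smul_smul, Int.cast_mul, mul_comm]⟩

/-- Membership in the annihilator ideal is `t f = 0` (unfolding `F1Sign2.heckeAnnihilator`). [folklore] -/
theorem mem_heckeAnnihilator_iff (t : HeckeRing0 N 2) : t ∈ heckeAnnihilator f ↔ HeckeRing0.toEnd N 2 t f = 0 :=
  Iff.rfl

/-- **`#(𝕋_ℤ ⧸ 𝔪_f) = 2` for the newform `f` of an elliptic curve**: `𝔪_f = Ann(f) + 2𝕋` has exactly the two classes `0̄, 1̄` — every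
`t` is congruent to the integer `m_t` by which it acts (`t − m_t ∈ Ann f`), and `1 ∉ 𝔪_f` since `f ≠ 0` and an odd integer does not kill
`f`. (REF1-AUDIT §34 recorded this modulo the named fact `IsNewform0.heckeEigenvalue_eq_coeff`, which is a tree theorem:
`IsNewform0.heckeT_eq_coeff_smul`.) [folklore] -/
theorem natCard_quotient_modTwoHeckeIdeal_eq_two (hf : IsNewformOf W f) :
    Nat.card (HeckeRing0 N 2 ⧸ modTwoHeckeIdeal f) = 2 := by
  classical
  have hf0 : f ≠ 0 := IsNewform0.ne_zero hf.1
  choose m hm using exists_int_toEnd_apply_eq_smul hf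
  -- `t - m_t ∈ Ann f`
  have hann : ∀ t : HeckeRing0 N 2, t - (m t : HeckeRing0 N 2) ∈ heckeAnnihilator f := by
    intro t
    rw [mem_heckeAnnihilator_iff, map_sub, map_intCast, LinearMap.sub_apply, hm, Module.End.intCast_apply,
      ← Int.cast_smul_eq_zsmul ℂ, sub_self]
  -- even integers lie in `𝔪_f`
  have heven : ∀ k : ℤ, ((2 * k : ℤ) : HeckeRing0 N 2) ∈ modTwoHeckeIdeal f := by
    intro k
    refine Submodule.mem_sup_right (Ideal.mem_span_singleton'.mpr ⟨(k : HeckeRing0 N 2), ?_⟩)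
    push_cast
    ring
  -- every class is `0̄` or `1̄`
  have hclass : ∀ t : HeckeRing0 N 2, Ideal.Quotient.mk (modTwoHeckeIdeal f) t = 0 ∨
      Ideal.Quotient.mk (modTwoHeckeIdeal f) t = 1 := by
    intro t
    rcases Int.emod_two_eq_zero_or_one (m t) with h | h
    · left
      rw [Ideal.Quotient.eq_zero_iff_mem]
      have ht : t = (t - (m t : HeckeRing0 N 2)) + ((2 * (m t / 2) : ℤ) : HeckeRing0 N 2) := by
        have : (2 * (m t / 2) : ℤ) = m t := by omega
        rw [this]; abel
      rw [ht]
      exact Submodule.add_mem _ (Submodule.mem_sup_left (hann t)) (heven _)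
    · right
      rw [← (Ideal.Quotient.mk (modTwoHeckeIdeal f)).map_one, Ideal.Quotient.eq]
      have ht : t - 1 = (t - (m t : HeckeRing0 N 2)) + ((2 * (m t / 2) : ℤ) : HeckeRing0 N 2) := by
        have : (2 * (m t / 2) : ℤ) = m t - 1 := by omega
        rw [this]; push_cast; abel
      rw [ht]
      exact Submodule.add_mem _ (Submodule.mem_sup_left (hann t)) (heven _)
  -- `0̄ ≠ 1̄`: `1 ∉ 𝔪_f`
  have h01 : (Ideal.Quotient.mk (modTwoHeckeIdeal f) 0) ≠ Ideal.Quotient.mk (modTwoHeckeIdeal f) 1 := by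
    intro h
    rw [Ideal.Quotient.eq, zero_sub] at h
    have h1 : (1 : HeckeRing0 N 2) ∈ modTwoHeckeIdeal f := by simpa using (modTwoHeckeIdeal f).neg_mem_iff.mp h
    obtain ⟨a, ha, b, hb, hab⟩ := Submodule.mem_sup.mp h1
    obtain ⟨c, rfl⟩ := Ideal.mem_span_singleton'.mp hb
    rw [mem_heckeAnnihilator_iff] at ha
    -- apply both sides of `a + c * 2 = 1` to `f`
    have happ := congrArg (fun s : HeckeRing0 N 2 => HeckeRing0.toEnd N 2 s f) hab
    simp only [map_add, map_mul, map_one, LinearMap.add_apply, Module.End.mul_apply, Module.End.one_apply, ha,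
      zero_add] at happ
    -- `toEnd 2 f = 2 • f`, `toEnd c (2 • f) = 2 m_c • f`
    have h2 : HeckeRing0.toEnd N 2 2 f = (2 : ℂ) • f := by
      rw [show (2 : HeckeRing0 N 2) = ((2 : ℤ) : HeckeRing0 N 2) by norm_cast, map_intCast, Module.End.intCast_apply,
        ← Int.cast_smul_eq_zsmul ℂ]
      norm_cast
    rw [h2, map_smul, hm] at happ
    -- `(2 * m c) • f = f` ⟹ `(2 m_c - 1) • f = 0` ⟹ contradiction
    have hsc : ((2 * m c - 1 : ℤ) : ℂ) • f = 0 := by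
      rw [Int.cast_sub, Int.cast_mul, sub_smul, mul_smul, Int.cast_one, one_smul, sub_eq_zero]
      simpa [smul_smul, mul_comm] using happ
    rcases smul_eq_zero.mp hsc with h0 | h0
    · have : (2 * m c - 1 : ℤ) = 0 := by exact_mod_cast h0
      omega
    · exact hf0 h0
  rw [Nat.card_eq_two_iff]
  refine ⟨Ideal.Quotient.mk _ 0, Ideal.Quotient.mk _ 1, h01, ?_⟩
  ext q
  simp only [Set.mem_insert_iff, Set.mem_singleton_iff, Set.mem_univ, iff_true]
  obtain ⟨t, rfl⟩ := Ideal.Quotient.mk_surjective q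
  rcases hclass t with h | h
  · left; rw [h, map_zero]
  · right; rw [h, map_one]

/-- **MULT2 ⟹ `#J₀(N)[𝔪_f] = 16` for the newform of an elliptic curve**, with no further input. [cite: KilfordWiese2008, Question 1.9] -/
theorem natCard_torsionBySet_eq_sixteen_of_isNewformOf (hf : IsNewformOf W f)
    (h4 : Module.finrank (HeckeRing0 N 2 ⧸ modTwoHeckeIdeal f)
      (Submodule.torsionBySet (HeckeRing0 N 2) (J0 N) (modTwoHeckeIdeal f)) = 4) :
    Nat.card (Submodule.torsionBySet (HeckeRing0 N 2) (J0 N) (modTwoHeckeIdeal f)) = 16 :=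
  natCard_eq_of_natCard_ring_eq_two (natCard_quotient_modTwoHeckeIdeal_eq_two hf) h4

end Newform

end Summit.BirchSwinnertonDyer.BirchSwinnertonDyer.Theorems.AlignedTransportAtTwoKilfordCopyMultiplicityCard

end
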